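import Summits.Ventures.PercRepro.S1Lever

/-!
# PercRepro — EVERY POINT LIES ON A TRIANGLE WHEN THE TRIANGLE COUNT EXCEEDS THE CAP ONE NULLITY DOWN (p8 g14, S3)

On a coloop-free `e`-free core of nullity `d + 1`, deleting a point `x` leaves an `e`-free core of nullity `d` with at
most `cq3 d` triangles (p3's table, `TriangleCap.core_ncard_triangles_le_cq3`), and `s₃ ≤ s₃(M ∖ x) + #(triangles through x)`
(p2's `S1.ncard_triangles_le_add_of_not_isColoop`); so with `s₃ > cq3 d` every point lies on a triangle
(`exists_triangle_through_of_cq3_lt`). At `(22, 12)`: `s₃ ≥ 25 > 24 = cq3 11`. Axioms: standard.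
-/

open scoped Matroid

namespace PercRepro

namespace ThmN

variable {α : Type}

/-- **Every point lies on a triangle** on a coloop-free `e`-free core of nullity `d + 1` with more than `cq3 d` triangles. -/
theorem exists_triangle_through_of_cq3_lt (M : Matroid α) [M.Finite]
    (hfree : ∀ e ∈ M.E, ∃ A ⊆ M.E \ {e}, e ∉ M.closure A ∧ e ∉ M.closure ((M.E \ {e}) \ A))
    (hcf : ∀ e ∈ M.E, ¬ M.IsColoop e) {d : ℕ} (hd : M.E.encard = M.eRank + ((d + 1 : ℕ) : ℕ∞))
    (hs : TriangleCap.cq3 d < {C : Set α | M.IsCircuit C ∧ C.ncard = 3}.ncard) :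
    ∀ x ∈ M.E, ∃ C, M.IsCircuit C ∧ C.ncard = 3 ∧ x ∈ C := by
  intro x hx
  have hL : ∀ e ∈ M.E, ¬ M.IsLoop e := not_isLoop_of_free M hfree
  have hC1 : ∀ L ⊆ M.E, M.eRk L = 2 → L.ncard ≤ 3 := by
    intro L hL' hr
    have := ncard_add_one_le_two_pow_of_eRk_le M hL hfree 2 L hL' hr.le
    omega
  have hC2 : ∀ P ⊆ M.E, M.eRk P ≤ 3 → P.ncard ≤ 6 := fun P hP hr =>
    ncard_le_six_of_eRk_le_three_of_free M hfree hP hr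
  obtain ⟨hd', -, -, hle⟩ := S1.ncard_triangles_le_add_of_not_isColoop M hC1 hC2 (d := d) hd hx (hcf x hx)
  have hrec : (triangles (M ＼ {x})).ncard ≤ TriangleCap.cq3 d :=
    TriangleCap.core_ncard_triangles_le_cq3 (M ＼ {x}) (S1.hfree_delete M hfree x) hd'
  have hpos : 0 < (trianglesThrough M x).ncard := by
    have h0 : (triangles M).ncard = {C : Set α | M.IsCircuit C ∧ C.ncard = 3}.ncard := rfl
    omega
  obtain ⟨C, hC⟩ := Set.nonempty_of_ncard_ne_zero (by omega : (trianglesThrough M x).ncard ≠ 0)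
  exact ⟨C, hC.1, hC.2.1, hC.2.2⟩

end ThmN

end PercRepro
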